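import Summits.RiemannHypothesis.RiemannHypothesis.Theorems.IntegerScrewTopBlockPosSoundC
import Summits.RiemannHypothesis.RiemannHypothesis.Theorems.ScrewManifestCertTopBlock

/-!
# P-POS soundness D: the small-phase strip and the bridge to `Manifest.TopBlockWavePos (21/50) 8 31`

Soundness of the P-POS kernel checker `IntegerScrewTopBlockPosDefs` for the crux `TopBlockWavePos31`
(= `Manifest.TopBlockWavePos (21/50) 8 31`) of route `ScrewNyquistFloor` (planner sos-theory gen17).
PROOF-ONLY module (all definitions, incl. the real twins `FR`, `mu`, `GoodBox`, …, live in `IntegerScrewTopBlockPosDefs`).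
Part D: on the strip `0 < φ ≤ 1/32` the quartic Taylor bound `k(1 − cos y) ≥ k y²/2 − (5/96) k⁺ y⁴`
(`Real.cos_bound`) with the CENTRED enclosure of `S₂(m) = Σ k (m_b − m_a)²`
(`S₂ ≥ S₂(m̄) − Σ_j |V_j| w_j − Σ |k| W_e²`) gives `strip_sound`, and `certifyStrip_sound` by induction.
Part E: the dictionary `x = 1/N`, `φ = t/N`, `μ_j(1/N) = N (log N − log (N − j))` identifies the wave
pairing `Σ_e tbC e (1 − cos (t · tbD N e))` of `ScrewManifestCertTopBlock` with `FR (t/N) (μ(1/N))`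
(`edgeL` IS the design `(tbA, tbB, tbK)`, checked by `decide`), and `topBlockWavePos_of_boxes`
turns `GoodBox 25600 344064 0 128` + `GoodStrip 0 128` into `TopBlockWavePos (21/50) 8 31`.
Nothing here bears on the truth of RH; the block `D16` is prime-free.
-/

set_option linter.dupNamespace false
set_option autoImplicit false

namespace Summit.RiemannHypothesis.RiemannHypothesis.Theorems.IntegerScrew.TopBlockPos

open Literature.Analysis.ValidatedNumerics Literature.Analysis.ValidatedNumerics.Numerics FI

/-! ## Soundness, part D: the small-phase strip `0 < φ ≤ 1/32` -/

section Strip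

variable {M0 M1 : List FI} {lo hi m : ℕ → ℝ}

/-- Per-edge Taylor bound: `k(1 − cos y) ≥ (k/2)y² − (5/96)k⁺|y|⁴` (`|y| ≤ 1` needed only for `k > 0`). -/
theorem edge_taylor (k : ℤ) (y : ℝ) (hy : |y| ≤ 1) :
    (k : ℝ) * y ^ 2 / 2 - (5 / 96) * (if 0 < k then (k : ℝ) else 0) * y ^ 4 ≤ k * (1 - Real.cos y) := by
  have hb := Real.cos_bound hy
  have h4 : |y| ^ 4 = y ^ 4 := by rw [show (4 : ℕ) = 2 * 2 from rfl, pow_mul, pow_mul, sq_abs]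
  rw [abs_le] at hb
  split_ifs with hk
  · have hk' : (0 : ℝ) < k := by exact_mod_cast hk
    nlinarith [hb.1, hb.2, h4]
  · have hk' : (k : ℝ) ≤ 0 := by exact_mod_cast not_lt.1 hk
    have hc := one_sub_cos_le_sq_half y
    nlinarith [hc, hk']

/-- Soundness/assembly step `memsT_stripT` (P-POS package; see the module docstring). -/
theorem memsT_stripT (hlo : ∀ j, j < 16 → mem (lo j) (getI M0 j))
    (hhi : ∀ j, j < 16 → mem (hi j) (getI M1 j)) :
    MemsT (edgeL.map (fSe lo hi)) (stripT M0 M1) := by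
  unfold stripT
  refine memsT_map edgeL fun e he => ?_
  obtain ⟨ha, hb, -⟩ := edgeL_wf e he
  have hd := mem_sub (mem_mbR hlo hhi hb) (mem_mbR hlo hhi ha)
  exact ⟨rfl, hd, mem_mulInt hd 2⟩

/-- Soundness/assembly step `MemsT.map_sq` (P-POS package; see the module docstring). -/
theorem MemsT.map_sq {R : List (ℤ × ℝ × ℝ)} {T : List (ℤ × FI × FI)} (h : MemsT R T) :
    Mems (R.map fun r => r.2.1 ^ 2 * (r.1 : ℝ)) (T.map fun d => (d.2.1.sqr).mulInt d.1) := by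
  induction h with
  | nil => exact List.Forall₂.nil
  | cons hx _ ih =>
    refine List.Forall₂.cons ?_ ih
    obtain ⟨h1, h2, -⟩ := hx
    show mem _ _; dsimp only; rw [h1]; exact mem_mulInt (mem_sqr h2) _

/-- `S₂(m) = Σ k (m_b − m_a)²` is at least the certified lower enclosure. -/
theorem S2_lower (hlo : ∀ j, j < 16 → mem (lo j) (getI M0 j)) (hhi : ∀ j, j < 16 → mem (hi j) (getI M1 j))
    (hm : ∀ j, lo j ≤ m j ∧ m j ≤ hi j) :
    ∃ X : ℝ, mem X (stripS2 M0 M1) ∧ X ≤ (edgeL.map fun e => (e.2.2 : ℝ) * (m e.2.1 - m e.1) ^ 2).sum := by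
  -- centred decomposition `Λ = Λ̄ + Δη`
  have hT := memsT_stripT hlo hhi (M0 := M0) (M1 := M1)
  -- (1) `Σ kΛ̄²`
  have h1 : mem (edgeL.map fun e => (mbR lo hi e.2.1 - mbR lo hi e.1) ^ 2 * (e.2.2 : ℝ)).sum
      (sumL ((stripT M0 M1).map fun d => (d.2.1.sqr).mulInt d.1)) := by
    have := hT.map_sq
    have h := this.sum; rw [List.map_map] at h; exact h
  -- (2) `Σ_j |V_j| w_j`
  have h2 : mem (∑ j ∈ Finset.range 16, |vertexSumR (edgeL.map (fSe lo hi)) edgeL j| * wR lo hi j)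
      (sumL ((List.range 16).map fun j =>
        (absUp (vertexSum (stripT M0 M1) edgeL j)).mul (getI (wList M0 M1) j))) := by
    rw [← sum_range_list]
    refine (mems_map (List.range 16) fun j hj => ?_).sum
    exact mem_mul (mem_absUp (mem_vertexSum hT edgeL j)) (mem_wR hlo hhi (List.mem_range.1 hj))
  -- (3) `Σ |k| W_e²`
  have h3 : mem (edgeL.map fun e => WR M0 M1 e ^ 2 * ((|e.2.2| : ℤ) : ℝ)).sum
      (sumL (edgeL.map fun e => ((ofScaled (wS M0 M1 e)).sqr).mulInt |e.2.2|)) :=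
    (mems_map edgeL fun e _ => mem_mulInt (mem_sqr (mem_ofScaled _)) _).sum
  refine ⟨_, mem_sub (mem_sub h1 h2) h3, ?_⟩
  -- the regrouped cross term
  have hreg := regroup edgeL (edgeL.map (fSe lo hi)) (by simp) edgeL_wf (fun j => m j - mbR lo hi j)
  rw [zip_map_self, List.map_map] at hreg
  have hcross : (edgeL.map fun e => (mbR lo hi e.2.1 - mbR lo hi e.1) * ((2 : ℤ) : ℝ) * (e.2.2 : ℝ) *
        ((m e.2.1 - mbR lo hi e.2.1) - (m e.1 - mbR lo hi e.1))).sum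
      = ∑ j ∈ Finset.range 16, (m j - mbR lo hi j) * vertexSumR (edgeL.map (fSe lo hi)) edgeL j := by
    rw [← hreg]; rfl
  have hcb : -(∑ j ∈ Finset.range 16, |vertexSumR (edgeL.map (fSe lo hi)) edgeL j| * wR lo hi j)
      ≤ ∑ j ∈ Finset.range 16, (m j - mbR lo hi j) * vertexSumR (edgeL.map (fSe lo hi)) edgeL j := by
    rw [← Finset.sum_neg_distrib]
    refine Finset.sum_le_sum fun j _ => ?_
    have e1 : |(m j - mbR lo hi j) * vertexSumR (edgeL.map (fSe lo hi)) edgeL j|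
        ≤ |vertexSumR (edgeL.map (fSe lo hi)) edgeL j| * wR lo hi j := by
      rw [abs_mul, mul_comm]; exact mul_le_mul_of_nonneg_left (abs_eta_le hm j) (abs_nonneg _)
    have e2 := neg_abs_le ((m j - mbR lo hi j) * vertexSumR (edgeL.map (fSe lo hi)) edgeL j)
    linarith
  -- termwise: kΛ² = kΛ̄² + 2kΛ̄Δη + kΔη² ≥ kΛ̄² + 2kΛ̄Δη − |k|W²
  have hterm : (edgeL.map fun e => (mbR lo hi e.2.1 - mbR lo hi e.1) ^ 2 * (e.2.2 : ℝ)).sum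
      + (edgeL.map fun e => (mbR lo hi e.2.1 - mbR lo hi e.1) * ((2 : ℤ) : ℝ) * (e.2.2 : ℝ) *
          ((m e.2.1 - mbR lo hi e.2.1) - (m e.1 - mbR lo hi e.1))).sum
      - (edgeL.map fun e => WR M0 M1 e ^ 2 * ((|e.2.2| : ℤ) : ℝ)).sum
      ≤ (edgeL.map fun e => (e.2.2 : ℝ) * (m e.2.1 - m e.1) ^ 2).sum := by
    rw [sub_le_iff_le_add, ← List.sum_map_add, ← List.sum_map_add]
    refine List.sum_le_sum fun e he => ?_
    obtain ⟨ha, hb, -⟩ := edgeL_wf e he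
    have hW := wR_add_le_WR hlo hhi ha hb (M0 := M0) (M1 := M1)
    have hηa := abs_eta_le hm e.1
    have hηb := abs_eta_le hm e.2.1
    have hk : ((|e.2.2| : ℤ) : ℝ) = |(e.2.2 : ℝ)| := Int.cast_abs
    rw [hk]
    have hΔ : |(m e.2.1 - mbR lo hi e.2.1) - (m e.1 - mbR lo hi e.1)| ≤ WR M0 M1 e := by
      have := abs_sub (m e.2.1 - mbR lo hi e.2.1) (m e.1 - mbR lo hi e.1); linarith
    have hsq : ((m e.2.1 - mbR lo hi e.2.1) - (m e.1 - mbR lo hi e.1)) ^ 2 ≤ WR M0 M1 e ^ 2 := by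
      rw [← sq_abs]; exact pow_le_pow_left₀ (abs_nonneg _) hΔ 2
    have hid : (e.2.2 : ℝ) * (m e.2.1 - m e.1) ^ 2
        = (mbR lo hi e.2.1 - mbR lo hi e.1) ^ 2 * (e.2.2 : ℝ)
          + (mbR lo hi e.2.1 - mbR lo hi e.1) * ((2 : ℤ) : ℝ) * (e.2.2 : ℝ) *
              ((m e.2.1 - mbR lo hi e.2.1) - (m e.1 - mbR lo hi e.1))
          + (e.2.2 : ℝ) * ((m e.2.1 - mbR lo hi e.2.1) - (m e.1 - mbR lo hi e.1)) ^ 2 := by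
      push_cast; ring
    rw [hid]
    have hkk := neg_abs_le (e.2.2 : ℝ)
    have hkk' := le_abs_self (e.2.2 : ℝ)
    nlinarith [hsq, sq_nonneg ((m e.2.1 - mbR lo hi e.2.1) - (m e.1 - mbR lo hi e.1)), abs_nonneg (e.2.2 : ℝ)]
  push_cast at hcross hterm ⊢
  linarith [hcross, hcb, hterm]

/-- `Σ_{k>0} k (m_b − m_a)⁴` is at most a member of `stripS4`. -/
theorem S4_upper (hlo : ∀ j, j < 16 → mem (lo j) (getI M0 j)) (hhi : ∀ j, j < 16 → mem (hi j) (getI M1 j))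
    (hm : ∀ j, lo j ≤ m j ∧ m j ≤ hi j) :
    ∃ Y : ℝ, mem Y (stripS4 M0 M1) ∧
      (edgeL.map fun e => (if 0 < e.2.2 then (e.2.2 : ℝ) else 0) * (m e.2.1 - m e.1) ^ 4).sum ≤ Y := by
  have h : mem (edgeL.map fun e => if 0 < e.2.2 then DR M0 M1 e ^ 4 * (e.2.2 : ℝ) else 0).sum
      (stripS4 M0 M1) := by
    unfold stripS4
    refine (mems_map edgeL fun e _ => ?_).sum
    split_ifs with hk
    · have := mem_mulInt (mem_sqr (mem_sqr (mem_ofScaled (dS M0 M1 e)))) e.2.2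
      rw [show (((dS M0 M1 e : ℝ) / SC) ^ 2) ^ 2 = DR M0 M1 e ^ 4 by unfold DR; ring] at this
      exact this
    · exact_mod_cast Numerics.FI.mem_ofInt 0
  refine ⟨_, h, List.sum_le_sum fun e he => ?_⟩
  obtain ⟨ha, hb, -⟩ := edgeL_wf e he
  split_ifs with hk
  · have hD := abs_dm_le_DR hlo hhi hm ha hb (M0 := M0) (M1 := M1)
    have h4 : (m e.2.1 - m e.1) ^ 4 ≤ DR M0 M1 e ^ 4 := by
      have : (m e.2.1 - m e.1) ^ 4 = |m e.2.1 - m e.1| ^ 4 := by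
        rw [show (4 : ℕ) = 2 * 2 from rfl, pow_mul, pow_mul, sq_abs]
      rw [this]; exact pow_le_pow_left₀ (abs_nonneg _) hD 4
    have hk' : (0 : ℝ) ≤ e.2.2 := by exact_mod_cast hk.le
    nlinarith [h4]
  · simp

/-- STRIP CELL SOUNDNESS. -/
theorem strip_sound (M0 M1 : List FI) (lo hi m : ℕ → ℝ)
    (hlo : ∀ j, j < 16 → mem (lo j) (getI M0 j)) (hhi : ∀ j, j < 16 → mem (hi j) (getI M1 j))
    (hm : ∀ j, lo j ≤ m j ∧ m j ≤ hi j) {φ : ℝ} (hφ0 : 0 < φ) (hφ1 : φ ≤ 1 / 32)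
    (hacc : stripAccept M0 M1 = true) : 0 < FR φ m := by
  unfold stripAccept at hacc
  simp only [Bool.and_eq_true, decide_eq_true_eq] at hacc
  obtain ⟨hmar, hdmax⟩ := hacc
  obtain ⟨X, hX, hXle⟩ := S2_lower hlo hhi hm (M0 := M0) (M1 := M1)
  obtain ⟨Y, hY, hYge⟩ := S4_upper hlo hhi hm (M0 := M0) (M1 := M1)
  -- the certified margin `X/2 − 5Y/98304 > 0`
  have hmg := mem_sub (mem_divNat hX (n := 2) two_pos) (mem_divNat (mem_mulInt hY 5) (n := 98304) (by norm_num))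
  have hpos := pos_of_lo_pos hmg hmar
  push_cast at hpos
  -- `|φ Λ_e| ≤ 1`
  have hdmax' : ((mkCol M0 M1).dmax : ℝ) / SC ≤ 32 := by
    rw [div_le_iff₀ SC_pos]; exact_mod_cast hdmax
  have hy : ∀ e ∈ edgeL, |φ * (m e.2.1 - m e.1)| ≤ 1 := by
    intro e he
    obtain ⟨ha, hb, -⟩ := edgeL_wf e he
    have hD := abs_dm_le_DR hlo hhi hm ha hb (M0 := M0) (M1 := M1)
    have hD' := DR_le_dmax he (M0 := M0) (M1 := M1)
    rw [abs_mul, abs_of_pos hφ0]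
    calc φ * |m e.2.1 - m e.1| ≤ (1 / 32) * 32 := by
          apply mul_le_mul hφ1 (hD.trans (hD'.trans hdmax')) (abs_nonneg _) (by norm_num)
      _ = 1 := by norm_num
  -- termwise Taylor and summation
  have hsum : φ ^ 2 / 2 * (edgeL.map fun e => (e.2.2 : ℝ) * (m e.2.1 - m e.1) ^ 2).sum
      + (-(5 / 96) * φ ^ 4) *
        (edgeL.map fun e => (if 0 < e.2.2 then (e.2.2 : ℝ) else 0) * (m e.2.1 - m e.1) ^ 4).sum
      ≤ FR φ m := by
    unfold FR
    rw [← List.sum_map_mul_left, ← List.sum_map_mul_left, ← List.sum_map_add]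
    refine List.sum_le_sum fun e he => ?_
    have ht := edge_taylor e.2.2 (φ * (m e.2.1 - m e.1)) (hy e he)
    have e1 : φ ^ 2 / 2 * ((e.2.2 : ℝ) * (m e.2.1 - m e.1) ^ 2)
        + (-(5 / 96) * φ ^ 4) * ((if 0 < e.2.2 then (e.2.2 : ℝ) else 0) * (m e.2.1 - m e.1) ^ 4)
        = (e.2.2 : ℝ) * (φ * (m e.2.1 - m e.1)) ^ 2 / 2
          - (5 / 96) * (if 0 < e.2.2 then (e.2.2 : ℝ) else 0) * (φ * (m e.2.1 - m e.1)) ^ 4 := by ring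
    rw [e1]; exact ht
  -- positivity of the quartic part and `φ² ≤ 1/1024`
  have hS4nn : 0 ≤ (edgeL.map fun e => (if 0 < e.2.2 then (e.2.2 : ℝ) else 0) * (m e.2.1 - m e.1) ^ 4).sum := by
    refine List.sum_nonneg ?_
    intro x hx
    obtain ⟨e, -, rfl⟩ := List.mem_map.1 hx
    split_ifs with hk
    · have hk' : (0 : ℝ) ≤ e.2.2 := by exact_mod_cast hk.le
      positivity
    · simp
  have hφ2 : φ ^ 2 ≤ 1 / 1024 := by
    rw [show (1 : ℝ) / 1024 = (1 / 32) ^ 2 by norm_num]; exact pow_le_pow_left₀ hφ0.le hφ1 2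
  have hφ2pos : 0 < φ ^ 2 := by positivity
  -- F ≥ φ²·(S₂/2 − (5/96)φ²S₄⁺) ≥ φ²·(X/2 − 5Y/98304) > 0
  have hYnn : 0 ≤ Y := hS4nn.trans hYge
  have key : φ ^ 2 * (X / 2 - Y * 5 / 98304) ≤ FR φ m := by
    have h4 : φ ^ 4 = φ ^ 2 * φ ^ 2 := by ring
    rw [h4] at hsum
    have p1 := mul_le_mul_of_nonneg_left hXle hφ2pos.le
    have p2 := mul_le_mul_of_nonneg_left (mul_le_mul_of_nonneg_right hφ2 hS4nn) hφ2pos.le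
    have p3 := mul_le_mul_of_nonneg_left hYge hφ2pos.le
    linarith [hsum, p1, p2, p3]
  have : 0 < φ ^ 2 * (X / 2 - Y * 5 / 98304) := mul_pos hφ2pos (by linarith)
  linarith

/-- Soundness/assembly step `goodStrip_of_accept` (P-POS package; see the module docstring). -/
theorem goodStrip_of_accept {X0 X1 : ℕ} (hX1 : X1 ≤ 128) (h0 : muTabOK X0 = true) (h1 : muTabOK X1 = true)
    (hacc : stripAccept (muTab X0) (muTab X1) = true) : GoodStrip X0 X1 := by
  intro x φ hx0 hx1 hφ0 hφ1
  have hxnn : 0 ≤ x := le_trans (by positivity) hx0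
  have hx15 : ∀ j : ℕ, j < 16 → (j : ℝ) * ((X1 : ℝ) / DX) < 1 := by
    intro j hj
    have hj15 : j ≤ 15 := by omega
    have hj' : (j : ℝ) ≤ 15 := by exact_mod_cast hj15
    have hX1' : (X1 : ℝ) ≤ 128 := by exact_mod_cast hX1
    rw [show (j : ℝ) * ((X1 : ℝ) / DX) = j * X1 / DX by ring, div_lt_one DX_pos]
    norm_num [DX]; nlinarith
  have hxj : ∀ j : ℕ, j < 16 → (j : ℝ) * x < 1 := fun j hj =>
    lt_of_le_of_lt (mul_le_mul_of_nonneg_left hx1 (Nat.cast_nonneg j)) (hx15 j hj)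
  set lo : ℕ → ℝ := fun j => if j < 16 then mu j ((X0 : ℝ) / DX) else 0 with hlo
  set hi : ℕ → ℝ := fun j => if j < 16 then mu j ((X1 : ℝ) / DX) else 0 with hhi
  set m : ℕ → ℝ := fun j => if j < 16 then mu j x else 0 with hmdef
  have hm : ∀ j, lo j ≤ m j ∧ m j ≤ hi j := by
    intro j
    by_cases hj : j < 16
    · simp only [hlo, hhi, hmdef, hj, if_true]
      exact ⟨mu_mono (by positivity) hx0 (hxj j hj), mu_mono hxnn hx1 (hx15 j hj)⟩
    · simp [hlo, hhi, hmdef, hj]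
  have hres := strip_sound (muTab X0) (muTab X1) lo hi m
    (fun j hj => by simp only [hlo, hj, if_true]; exact mem_muTab h0 hj)
    (fun j hj => by simp only [hhi, hj, if_true]; exact mem_muTab h1 hj) hm hφ0 hφ1 hacc
  rwa [FR_congr (m := m) (m' := fun j => mu j x) (fun j hj => by simp [hmdef, hj])] at hres

/-- Soundness/assembly step `goodStrip_union` (P-POS package; see the module docstring). -/
theorem goodStrip_union {X0 Xm X1 : ℕ} (h1 : GoodStrip X0 Xm) (h2 : GoodStrip Xm X1) : GoodStrip X0 X1 := by
  intro x φ hx0 hx1 hφ0 hφ1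
  rcases le_total x ((Xm : ℝ) / DX) with h | h
  · exact h1 x φ hx0 h hφ0 hφ1
  · exact h2 x φ h hx1 hφ0 hφ1

/-- SOUNDNESS OF THE STRIP CHECKER. -/
theorem certifyStrip_sound : ∀ (fuel X0 X1 : ℕ), X1 ≤ 128 →
    certifyStrip fuel X0 X1 = true → GoodStrip X0 X1 := by
  intro fuel
  induction fuel with
  | zero => intro X0 X1 _ h; simp [certifyStrip] at h
  | succ fuel ih =>
    intro X0 X1 hX1 h
    rw [certifyStrip] at h
    simp only [Bool.or_eq_true, Bool.and_eq_true, decide_eq_true_eq] at h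
    obtain ⟨⟨h0, h1⟩, h⟩ := h
    rcases h with hacc | ⟨⟨hlt, hA⟩, hB⟩
    · exact goodStrip_of_accept hX1 h0 h1 hacc
    · exact goodStrip_union (ih _ _ (by omega) hA) (ih _ _ hX1 hB)

end Strip




/-! ## Part E: the bridge to `Manifest.TopBlockWavePos (21/50) 8 31`

Dictionary: `x = 1/N`, `φ = t/N`; `μ_j(1/N) = N (log N − log (N − j))`, so
`φ (μ_b − μ_a) = t (log (N − a) − log (N − b)) = t · tbD N e`; the window `t ≤ (21/50)(N − 8)` is
`50 φ + 168 x ≤ 21`; `N ≥ 31` is `x ≤ 128/DX = 1/31`. -/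

section Final

open Summit.RiemannHypothesis.RiemannHypothesis.Theorems.IntegerScrew.Manifest
  (tbE tbA tbB tbK tbC tbD TopBlockWavePos tbA_lt_sixteen tbB_lt_sixteen)

/-- The edge list of the checker IS the design `D16` of `ScrewManifestCertTopBlock`. -/
theorem edgeL_eq_ofFn : edgeL = List.ofFn (fun e : Fin tbE => (tbA e, tbB e, tbK e)) := by
  decide +kernel

/-- Soundness/assembly step `mu_inv` (P-POS package; see the module docstring). -/
theorem mu_inv (N j : ℕ) (hN : 0 < N) (hj : j < N) :
    mu j (1 / (N : ℝ)) = (N : ℝ) * (Real.log N - Real.log ((N : ℝ) - j)) := by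
  unfold mu
  have hNr : (0 : ℝ) < N := by exact_mod_cast hN
  have hne : (1 : ℝ) / N ≠ 0 := by positivity
  rw [if_neg hne]
  have hjr : (j : ℝ) < N := by exact_mod_cast hj
  have hNj : (0 : ℝ) < (N : ℝ) - j := by linarith
  have e1 : 1 - (j : ℝ) * (1 / N) = ((N : ℝ) - j) / N := by field_simp
  rw [e1, Real.log_div hNj.ne' hNr.ne']
  field_simp
  ring

/-- The wave pairing of `D16` at `(N, t)` is the checker functional at `(φ, x) = (t/N, 1/N)`. -/
theorem wave_sum_eq (N : ℕ) (hN : 16 ≤ N) (t : ℝ) :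
    ∑ e, tbC e * (1 - Real.cos (t * tbD N e)) = FR (t / N) (fun j => mu j (1 / (N : ℝ))) := by
  unfold FR
  rw [edgeL_eq_ofFn, List.map_ofFn, List.sum_ofFn]
  refine Finset.sum_congr rfl fun e _ => ?_
  have ha := tbA_lt_sixteen e
  have hb := tbB_lt_sixteen e
  have hNr : (N : ℝ) ≠ 0 := Nat.cast_ne_zero.2 (by omega)
  simp only [Function.comp_apply, tbC, tbD]
  rw [mu_inv N _ (by omega) (by omega), mu_inv N _ (by omega) (by omega)]
  congr 3
  field_simp
  ring

/-- FINAL BRIDGE: the two certified regions give the crux statement `(POS)` of the route. -/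
theorem topBlockWavePos_of_boxes (hmain : GoodBox 25600 344064 0 128) (hstrip : GoodStrip 0 128) :
    TopBlockWavePos (21 / 50) 8 31 := by
  intro N hN t ht htN
  have hN0 : 0 < N := by omega
  have hNr : (0 : ℝ) < N := by exact_mod_cast hN0
  have hN31 : (31 : ℝ) ≤ N := by exact_mod_cast hN
  rw [wave_sum_eq N (by omega) t]
  set x : ℝ := 1 / (N : ℝ) with hxdef
  set φ : ℝ := t / (N : ℝ) with hφdef
  have hx0 : ((0 : ℕ) : ℝ) / DX ≤ x := by rw [hxdef]; simp only [Nat.cast_zero, zero_div]; positivity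
  have hx1 : x ≤ ((128 : ℕ) : ℝ) / DX := by
    rw [hxdef, div_le_div_iff₀ hNr DX_pos]; norm_num [DX]; linarith
  have hxpos : 0 < x := by rw [hxdef]; positivity
  have hφpos : 0 < φ := by rw [hφdef]; positivity
  have hwin : 50 * φ + 168 * x ≤ 21 := by
    rw [hφdef, hxdef]
    have : 50 * (t / N) + 168 * (1 / N) = (50 * t + 168) / N := by field_simp
    rw [this, div_le_iff₀ hNr]; nlinarith
  rcases le_or_gt φ (1 / 32) with h32 | h32
  · exact (hstrip x φ hx0 hx1 hφpos h32).le
  · have hφ0 : ((25600 : ℕ) : ℝ) / DP ≤ φ := by norm_num [DP]; linarith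
    rcases le_or_gt φ (((344064 : ℕ) : ℝ) / DP) with h42 | h42
    · exact (hmain x φ hx0 hx1 hφ0 h42 hwin).le
    · exfalso; norm_num [DP] at h42; linarith

end Final

end Summit.RiemannHypothesis.RiemannHypothesis.Theorems.IntegerScrew.TopBlockPos
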